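import Mathlib.Analysis.Calculus.ParametricIntegral
import Mathlib.MeasureTheory.Integral.Bochner.Basic

/-!
# T⁴ programme, spine node NE1′ (O3b/H2), COUPLING LINE — ANALYTICITY OF THE NORMALISED STEP EXPECTATION ALONG A COMPLEX LINE
# OF LOCAL DATA = differentiation under the integral sign over a FIXED finite region (skeleton `t4/skeletons/NE1p-t4-ne1p-p3.md`
# v0.12.x §3d, clause (iii) of IL-LOCAL)

Cell `pub-balaban`, unit `b2b-balaban-t4-ne1p-p3` (ROUND-2 technique-distinct prover #3 on BINDER row NE1′), generation 31.  OUR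
elementary lemmas (new work ⇒ `Summits/`), Mathlib only, everything PROVED, no `def`; nothing of T. Bałaban's series is asserted.
Companions (this lineage, this generation): `Support/NE1pLocalPhase` (p210978: (i) the denominator does not vanish and (ii) the
bound `‖⟨Φ⟩‖ ≤ sup‖Φ‖/cos Θ` under a bounded local phase), `Support/NE1pPathwiseBlock` (p209631: the Schwarz step that CONSUMES
the analyticity proved here), `Support/NE1pShrinkPhase` (p211350).

THE POINT (§3d (iii)).  On the «locally complex data» route the undressed small-field step with data on a complex line
`t ↦ V_t` is `⟨Φ⟩(t) = (∫_𝒜 e^{−S(t,a)} da)⁻¹ • ∫_𝒜 e^{−S(t,a)} Φ(t,a) da` over a FIXED real cut-off region `𝒜` of finite measure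
(printed structure: [Balaban1988Convergent] (3.15)/(3.16) p. 268 with the operator C, p. 267 — a LOCATOR, asserted of nothing
here), with integrands complex-differentiable in `t` and bounded together with their `t`-derivatives on the region, uniformly for
`t` in an open set `U`.  Then numerator and denominator are complex-differentiable on `U` (differentiation under the integral
sign, Mathlib `hasDerivAt_integral_of_dominated_loc_of_deriv_le` with a CONSTANT dominating function on a finite measure), and so
is the normalised expectation wherever the denominator does not vanish (which `NE1pLocalPhase.integral_phase_ne_zero` supplies
under `Θ < π/2`).  This is ALL the analyticity the Schwarz step needs — no cluster expansion, no convergence of a logarithm.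
HONEST: the uniform bounds on the integrand and its `t`-derivative over the cut-off region are printed-TYPE inputs (the step's
exponent is analytic in the data on the printed spaces (2.34)–(2.39) p. 261 with Cauchy bounds), hypotheses here.

HONEST FRAMING (T4-DAG p. 1).  Rung (B)+1 on ONE finite four-torus of fixed physical size; NOT infinite volume, NOT a mass gap,
NOT the Clay problem, NOT summit progress.  NE1′ is NOT printed and NOT proved (spine 0/9).  HONEST DEPENDENCY (verbatim):
continuum YM on T⁴ ⇐ BetaPertH ∧ nine spine estimates (0/9 proved); BetaPertH ⇐ (D1) ∧ (D4) ∧ CAP+tail; G-an2-4 gates asym, D1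
and NE2/3/4.  CITATION HEADER: no page of the series is quoted as an input.

WHAT IS PROVED ([folklore], Mathlib only): `integrable_of_norm_le_const` (bounded a.e.-measurable ⇒ integrable on a finite
measure), `hasDerivAt_integral_of_const_bounds` / `differentiableOn_integral_of_const_bounds` (differentiation under the integral
sign with constant bounds on an open set), `differentiableOn_inv_smul` (the normalised expectation `g⁻¹ • f` is differentiable where
`g ≠ 0`), `differentiableOn_normalisedIntegral` (the assembled clause (iii)).
-/

noncomputable section

open MeasureTheory Metric Set Filter Topology

namespace Summit.QuantumFields.BalabanUV.T4Continuum.NE1pParametricStep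

variable {Ω : Type*} [MeasurableSpace Ω] {μ : Measure Ω} [IsFiniteMeasure μ]
variable {E : Type*} [NormedAddCommGroup E] [NormedSpace ℂ E]

omit [NormedSpace ℂ E] in
/-- A bounded a.e.-strongly-measurable function is integrable against a finite measure. [folklore] -/
theorem integrable_of_norm_le_const {f : Ω → E} {B : ℝ} (hf : AEStronglyMeasurable f μ) (hB : ∀ᵐ a ∂μ, ‖f a‖ ≤ B) :
    Integrable f μ :=
  (integrable_const B).mono' hf hB

/-- **DIFFERENTIATION UNDER THE INTEGRAL SIGN WITH CONSTANT BOUNDS** (pointwise form).  `F : ℂ → Ω → E` with `F t` a.e.-strongly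
measurable for `t ∈ U` (`U` open), `‖F t₀ ·‖ ≤ B` a.e., a.e. in `a` the map `t ↦ F t a` has derivative `F′ t a` at every `t ∈ U`
with `‖F′ t a‖ ≤ B′`, and `F′ t₀` a.e.-strongly measurable: then `t ↦ ∫ F t dμ` has derivative `∫ F′ t₀ dμ` at `t₀ ∈ U`. [folklore] -/
theorem hasDerivAt_integral_of_const_bounds {F F' : ℂ → Ω → E} {U : Set ℂ} {B B' : ℝ} {t₀ : ℂ} (hU : IsOpen U) (ht₀ : t₀ ∈ U)
    (hmeas : ∀ t ∈ U, AEStronglyMeasurable (F t) μ) (hB : ∀ᵐ a ∂μ, ‖F t₀ a‖ ≤ B)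
    (hmeas' : AEStronglyMeasurable (F' t₀) μ) (hB' : ∀ᵐ a ∂μ, ∀ t ∈ U, ‖F' t a‖ ≤ B')
    (hdiff : ∀ᵐ a ∂μ, ∀ t ∈ U, HasDerivAt (fun s => F s a) (F' t a) t) :
    HasDerivAt (fun t => ∫ a, F t a ∂μ) (∫ a, F' t₀ a ∂μ) t₀ := by
  have hUn : U ∈ 𝓝 t₀ := hU.mem_nhds ht₀
  have hF_meas : ∀ᶠ t in 𝓝 t₀, AEStronglyMeasurable (F t) μ :=
    Filter.eventually_of_mem hUn fun t ht => hmeas t ht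
  have hF_int : Integrable (F t₀) μ := integrable_of_norm_le_const (hmeas t₀ ht₀) hB
  exact (hasDerivAt_integral_of_dominated_loc_of_deriv_le (bound := fun _ => B') hUn hF_meas hF_int hmeas' hB'
    (integrable_const B') hdiff).2

/-- **DIFFERENTIATION UNDER THE INTEGRAL SIGN WITH CONSTANT BOUNDS** (set form): under the same hypotheses at every point of
the open set `U`, `t ↦ ∫ F t dμ` is complex-differentiable on `U`.  Reading (§3d): `F t a = e^{−S(V_t)(a)}` (denominator) or
`e^{−S(V_t)(a)}·Φ(V_t, a)` (numerator) over the fixed cut-off region. [folklore] -/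
theorem differentiableOn_integral_of_const_bounds {F F' : ℂ → Ω → E} {U : Set ℂ} {B B' : ℝ} (hU : IsOpen U)
    (hmeas : ∀ t ∈ U, AEStronglyMeasurable (F t) μ) (hB : ∀ t ∈ U, ∀ᵐ a ∂μ, ‖F t a‖ ≤ B)
    (hmeas' : ∀ t ∈ U, AEStronglyMeasurable (F' t) μ) (hB' : ∀ᵐ a ∂μ, ∀ t ∈ U, ‖F' t a‖ ≤ B')
    (hdiff : ∀ᵐ a ∂μ, ∀ t ∈ U, HasDerivAt (fun s => F s a) (F' t a) t) :
    DifferentiableOn ℂ (fun t => ∫ a, F t a ∂μ) U := fun t₀ ht₀ =>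
  (hasDerivAt_integral_of_const_bounds hU ht₀ hmeas (hB t₀ ht₀) (hmeas' t₀ ht₀) hB' hdiff).differentiableAt
    |>.differentiableWithinAt

omit [MeasurableSpace Ω] [IsFiniteMeasure μ] in
/-- The normalised expectation `g⁻¹ • f` is complex-differentiable where numerator and denominator are and the denominator does
not vanish. [folklore] -/
theorem differentiableOn_inv_smul {f : ℂ → E} {g : ℂ → ℂ} {U : Set ℂ} (hf : DifferentiableOn ℂ f U)
    (hg : DifferentiableOn ℂ g U) (hne : ∀ t ∈ U, g t ≠ 0) :
    DifferentiableOn ℂ (fun t => (g t)⁻¹ • f t) U :=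
  (hg.inv hne).smul hf

/-- **CLAUSE (iii) OF IL-LOCAL, ASSEMBLED.**  Numerator `∫ N t dμ` (values in `E`) and denominator `∫ D t dμ` (complex) with
constant bounds on themselves and their `t`-derivatives over the fixed finite region, derivatives existing a.e. for all `t ∈ U`,
denominator non-vanishing on `U` (supplied under a bounded local phase by `NE1pLocalPhase.integral_phase_ne_zero`): the normalised
expectation `t ↦ (∫ D t dμ)⁻¹ • ∫ N t dμ` is complex-differentiable on `U` — exactly the input `DifferentiableOn ℂ (Φ ∘ γ) (ball 0 R₁)`
of `NE1pPathwiseBlock.norm_le_div_mul_norm_of_line`. [folklore] -/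
theorem differentiableOn_normalisedIntegral {N N' : ℂ → Ω → E} {D D' : ℂ → Ω → ℂ} {U : Set ℂ} {B B' C C' : ℝ}
    (hU : IsOpen U)
    (hNm : ∀ t ∈ U, AEStronglyMeasurable (N t) μ) (hNB : ∀ t ∈ U, ∀ᵐ a ∂μ, ‖N t a‖ ≤ B)
    (hNm' : ∀ t ∈ U, AEStronglyMeasurable (N' t) μ) (hNB' : ∀ᵐ a ∂μ, ∀ t ∈ U, ‖N' t a‖ ≤ B')
    (hNd : ∀ᵐ a ∂μ, ∀ t ∈ U, HasDerivAt (fun s => N s a) (N' t a) t)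
    (hDm : ∀ t ∈ U, AEStronglyMeasurable (D t) μ) (hDB : ∀ t ∈ U, ∀ᵐ a ∂μ, ‖D t a‖ ≤ C)
    (hDm' : ∀ t ∈ U, AEStronglyMeasurable (D' t) μ) (hDB' : ∀ᵐ a ∂μ, ∀ t ∈ U, ‖D' t a‖ ≤ C')
    (hDd : ∀ᵐ a ∂μ, ∀ t ∈ U, HasDerivAt (fun s => D s a) (D' t a) t)
    (hne : ∀ t ∈ U, ∫ a, D t a ∂μ ≠ 0) :
    DifferentiableOn ℂ (fun t => (∫ a, D t a ∂μ)⁻¹ • ∫ a, N t a ∂μ) U :=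
  differentiableOn_inv_smul (differentiableOn_integral_of_const_bounds hU hNm hNB hNm' hNB' hNd)
    (differentiableOn_integral_of_const_bounds hU hDm hDB hDm' hDB' hDd) hne

end Summit.QuantumFields.BalabanUV.T4Continuum.NE1pParametricStep
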